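import Summits.ResolutionOfSingularities.ResolutionOfSingularities.Theorems.RadicialJungCleanModelsT2BlowupStalkChart
import HarnessLib

/-!
# Route `RadicialJung`, crux `CleanModels` (stmt-15917): the image `T ≤ K(X)` of a local ring of a
# point blow-up is the localised chart `R[v/u]_Q` — as an `R[v/u]`-ALGEBRA BY INCLUSION
# (T2 brick B5-a, part 4)

Support file (OURS) for PROGRAMME-clean-dim2 / T2, companion of
`RadicialJungCleanModelsT2BlowupStalkChart.lean` (part 1: `T = (LocalSubring.ofPrime (R[v/u]) Q)` as
subrings) and `…BlowupStalkChartLoc.lean` (part 2: the stalk itself as `R[v/u]_Q`). Here the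
localisation structure is put on the SUBRING `T = im ε_{x′}` with the algebra structure given by the
inclusion `R[v/u] ≤ T` — the literal shape `[Algebra (chartAdjoin x y) T] (= inclusion)
[IsLocalization.AtPrime T Q]` of res-L0-w81-pv-1's `giraudColength_lt_of_nonCrossing_chart` /
`…_of_crossing_chart` (STATUS 20:56:36Z). Nothing here is a statement of Hironaka's manuscript.

* `isLocalization_atPrime_range_stalkEmb` — `@IsLocalization.AtPrime (chartAdjoin u v) _ T _
  (Subring.inclusion hle).toAlgebra Q _`, `Q = 𝔪_T ∩ R[v/u]`, in the `u`-chart (`u ≠ 0`).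
-/

noncomputable section

set_option linter.dupNamespace false -- mandated namespace of this single-conjunct summit

open CategoryTheory AlgebraicGeometry TopologicalSpace IsLocalRing
open Literature.AlgebraicGeometry.Resolution

namespace Summit.ResolutionOfSingularities.ResolutionOfSingularities.Theorems.RadicialJung.CleanModels.T2

universe u

open Scheme.IdealSheafData

variable {X₁ X : Scheme.{u}} [IsIntegral X] [IsLocallyNoetherian X] {π : X₁ ⟶ X}
  {J : X.IdealSheafData}

/-- **`T = im ε_{x′}` is the localisation `R[v/u]_Q` for the INCLUSION algebra structure**
(`u`-chart, `u ≠ 0`, `Q = 𝔪_T ∩ R[v/u]`). [cite: HunekeSwanson2006, §14.2 (p. 264)] -/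
theorem isLocalization_atPrime_range_stalkEmb (hπ : IsBlowup π J) (x' : X₁)
    (hJ : stalkIdeal J (π x') = maximalIdeal (X.presheaf.stalk (π x')))
    (u v : X.presheaf.stalk (π x')) (huv : maximalIdeal (X.presheaf.stalk (π x')) = Ideal.span {u, v})
    (hu0 : u ≠ 0)
    (hle : haveI := isLocalRing_range_algebraMap_stalk (X := X) (π x')
      chartAdjoin (K := X.functionField)
        (⟨algebraMap _ X.functionField u, u, rfl⟩ :
          (algebraMap (X.presheaf.stalk (π x')) X.functionField).range)
        ⟨algebraMap _ X.functionField v, v, rfl⟩ ≤ (hπ.stalkEmb x').range) :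
    haveI := isLocalRing_range_algebraMap_stalk (X := X) (π x')
    haveI := isLocalRing_range_stalkEmb hπ x'
    @IsLocalization.AtPrime _ _ (hπ.stalkEmb x').range _ (Subring.inclusion hle).toAlgebra
      ((maximalIdeal (hπ.stalkEmb x').range).comap (Subring.inclusion hle)) _ := by
  haveI := isLocalRing_range_algebraMap_stalk (X := X) (π x')
  haveI := isLocalRing_range_stalkEmb hπ x'
  have hTeq := range_stalkEmb_eq_ofPrime_chartAdjoin hπ x' hJ u v huv hu0 hle
  set A := chartAdjoin (K := X.functionField)
    (⟨algebraMap _ X.functionField u, u, rfl⟩ :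
      (algebraMap (X.presheaf.stalk (π x')) X.functionField).range)
    ⟨algebraMap _ X.functionField v, v, rfl⟩ with hA
  set Q : Ideal A := (maximalIdeal (hπ.stalkEmb x').range).comap (Subring.inclusion hle) with hQ
  letI : Algebra A (hπ.stalkEmb x').range := (Subring.inclusion hle).toAlgebra
  let e₀ : (LocalSubring.ofPrime A Q).toSubring ≃+* (hπ.stalkEmb x').range :=
    RingEquiv.subringCongr hTeq.symm
  have e : (LocalSubring.ofPrime A Q).toSubring ≃ₐ[A] (hπ.stalkEmb x').range :=
    AlgEquiv.ofRingEquiv (f := e₀) fun a => Subtype.ext rfl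
  exact IsLocalization.isLocalization_of_algEquiv Q.primeCompl e

end Summit.ResolutionOfSingularities.ResolutionOfSingularities.Theorems.RadicialJung.CleanModels.T2

end
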